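/-
Copyright (c) 2026 the pub-hodgecm-mathlib formalisation cell (harness21).  Prover seat hodgecm-mathlib-K2E5-p16 (g5): Track B «K2-LIT»,
hLiu418 = stmt-HodgeConjecture-24832, ROAD Φ organ Φ6b-5, file (6a′): the ABSTRACT head factored out of ★ (6a) — holomorphy of a lattice
series `Σ_i c_i(s) ∏_σ F_{iσ}(s)` from holomorphy + three-factor bounds of the factors (K2E5-plan (g6) deal 2026-09-04T09:35:45Z, LEAD
F0P6-plan (g13) 09:46:01Z (2)); with the `(d∕dt)^n ξ(g₀ + tΞ, ·)|₀` instance by ★ (7c)∕(7d); 2026-09-04.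
-/
import Summits.HodgeConjecture.HodgeConjecture.Theorems.K2LiuHermTwoXiSeriesLattice           -- ★ (6a): `one_add_rpow_neg_le_two_mul`
import Summits.HodgeConjecture.HodgeConjecture.Theorems.K2LiuHermTwoXiShiftCauchyDerivatives   -- ★ (7d) (+ (7b), (7c))
import HarnessLib

/-!
# Crux `HLiu418`, ROAD Φ, organ Φ6b-5 — file (6a′): holomorphic lattice series from bounds (abstract head), and its `(d∕dt)^n ξ` instance

Cell `hodgecm-mathlib`, crux item hLiu418 = `stmt-HodgeConjecture-24832`, route of record `HCCMUnconditional`; squad K2, LEAD F0P6-plan (g13),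
co-dealer ∕ Φ6b word-holder K2E5-plan (g6), prover K2E5-p16 (g5).  THEOREMS ONLY; lane `--supports stmt-HodgeConjecture-24832 --as helper`.

WHAT.
* `differentiableOn_tsum_prod_of_bounds` — THE ABSTRACT HEAD.  Data: places `σ : S` (finite), lattice index `i : ι`, positive definite
  `h_{iσ}`, nonnegative weights `w_{iσ}` (typically `exp(−κ re tr(h_{iσ} g′_σ))`), factors `F i σ : ℂ → ℂ` holomorphic on an open `U` with,
  on every compact `K ⊆ U` and at every place, a THREE-FACTOR BOUND `‖F i σ s‖ ≤ C_σ · w_{iσ} · (1 + tr h_{iσ})^{N_σ} · (1 + det h_{iσ}^{−N′_σ})`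
  uniform in `i` and `s ∈ K`; coefficients `c i` holomorphic on `U` of polynomial growth `‖c i s‖ ≤ A ∏_σ (1 + tr h_{iσ})^M` on compacts; and
  the lattice summability `Σ_i ∏_σ w_{iσ} (1 + tr)^N (1 + det^{−N′}) < ∞` for all `N, N′ ≥ 0` (★ (H2) `summable_lattice_prod_majorant` for the
  exponential weights).  Conclusion: `s ↦ Σ'_i c i s · ∏_σ F i σ s` is holomorphic on `U` (M-test on small balls; exponents merged across
  places by monotonicity and ★ `one_add_rpow_neg_le_two_mul`).  ★ (6a) `differentiableOn_tsum_prod_xiShift` is the instance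
  `F i σ s = xiShift (g σ) (h i σ) (α₀σ + us) (β₀σ + vs)`, `w = exp(−2π re tr(h g))` (★ (4b-iii) + ★ (5)).
* `differentiableOn_tsum_prod_iteratedDeriv_xiShift` — THE GENERAL-`K_∞`-TYPE INSTANCE: `F i σ s = (d∕dt)^{n_σ} xiShift (g₀σ + t Ξ_σ) (h i σ)
  (α₀σ + us) (β₀σ + vs) |_{t=0}` (`g₀σ = hermTwo (d σ) > 0`, any `Ξ_σ`, any orders `n_σ`), weight `exp(−π re tr(h_{iσ} g₀σ))`: holomorphic on
  `U` by ★ (7d), three-factor bound by ★ (7c) (`norm_xiShift_param_le₂` on the disc + the Cauchy estimate `norm_iteratedDeriv_xiShift_param_le`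
  at `ρ = r∕2`).  This is the face Φ9's assembly for an ARBITRARY `K_∞`-type consumes by `exact` (finite combinations: apply it termwise).
HONEST LABEL.  Count-neutral helper of the K2_Liu road; it pays no socket by itself: `HC_CM` is proved only modulo the 7 printed citations
(2 remaining named inputs: hLiu418 = `stmt-HodgeConjecture-24832`, h413 = `stmt-HodgeConjecture-24833`) until rung 0 closes.
-/

set_option autoImplicit false
-- the mandated namespace repeats the single-problem summit's segment (`HodgeConjecture.HodgeConjecture`)
set_option linter.dupNamespace false

noncomputable section

open Complex Set
open scoped ComplexOrder ComplexConjugate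

namespace Summit.HodgeConjecture.HodgeConjecture.Cruxes.HLiu418.K2LiuHolomorphicLatticeSeriesOfBounds

open Summit.HodgeConjecture.HodgeConjecture.Cruxes.HLiu418.K2LiuHermTwoGammaDefs
open Summit.HodgeConjecture.HodgeConjecture.Cruxes.HLiu418.K2LiuHermTwoEtaShiftDefs
open Summit.HodgeConjecture.HodgeConjecture.Cruxes.HLiu418.K2LiuHermTwoXiSeries
open Summit.HodgeConjecture.HodgeConjecture.Cruxes.HLiu418.K2LiuHermTwoXiSeriesLattice
open Summit.HodgeConjecture.HodgeConjecture.Cruxes.HLiu418.K2LiuHermTwoXiShiftParamHolomorphy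
open Summit.HodgeConjecture.HodgeConjecture.Cruxes.HLiu418.K2LiuHermTwoXiShiftParamGrowth
open Summit.HodgeConjecture.HodgeConjecture.Cruxes.HLiu418.K2LiuHermTwoXiShiftCauchyDerivatives

/-! ## §1 The abstract head -/

/-- **HOLOMORPHIC LATTICE SERIES FROM BOUNDS** (abstract head of Φ6b-5): see the module docstring.  The three-factor bound is asked per place
`σ` (constants `C_σ, N_σ, N′_σ ≥ 0` uniform in the lattice index and in `s` on the compact); the weights `w i σ ≥ 0` are arbitrary. -/
theorem differentiableOn_tsum_prod_of_bounds {ι S : Type*} [Fintype S] (h : ι → S → Matrix (Fin 2) (Fin 2) ℂ) (hh : ∀ i σ, (h i σ).PosDef)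
    (w : ι → S → ℝ) (hw : ∀ i σ, 0 ≤ w i σ) (F : ι → S → ℂ → ℂ) {U : Set ℂ} (hU : IsOpen U) (hF : ∀ i σ, DifferentiableOn ℂ (F i σ) U)
    (hFb : ∀ K ⊆ U, IsCompact K → ∀ σ, ∃ C N N' : ℝ, 0 ≤ C ∧ 0 ≤ N ∧ 0 ≤ N' ∧ ∀ i, ∀ s ∈ K,
      ‖F i σ s‖ ≤ C * w i σ * (1 + ((h i σ 0 0).re + (h i σ 1 1).re)) ^ N * (1 + ((h i σ 0 0).re * (h i σ 1 1).re - normSq (h i σ 0 1)) ^ (-N')))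
    (c : ι → ℂ → ℂ) (hc : ∀ i, DifferentiableOn ℂ (c i) U)
    (hcb : ∀ K ⊆ U, IsCompact K → ∃ A M : ℝ, 0 ≤ A ∧ ∀ i, ∀ s ∈ K, ‖c i s‖ ≤ A * ∏ σ, (1 + ((h i σ 0 0).re + (h i σ 1 1).re)) ^ M)
    (hsum : ∀ N N' : ℝ, 0 ≤ N → 0 ≤ N' → Summable fun i => ∏ σ, (w i σ *
      (1 + ((h i σ 0 0).re + (h i σ 1 1).re)) ^ N * (1 + ((h i σ 0 0).re * (h i σ 1 1).re - normSq (h i σ 0 1)) ^ (-N')))) :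
    DifferentiableOn ℂ (fun s : ℂ => ∑' i, c i s * ∏ σ, F i σ s) U := by
  intro s₀ hs₀
  obtain ⟨r, hr, hball⟩ := Metric.isOpen_iff.mp hU s₀ hs₀
  have hr2 : 0 < r / 2 := by linarith
  have hKU : Metric.closedBall s₀ (r / 2) ⊆ U := (Metric.closedBall_subset_ball (by linarith)).trans hball
  have hKc : IsCompact (Metric.closedBall s₀ (r / 2)) := isCompact_closedBall _ _
  choose C N N' hC hN hN' hB using hFb _ hKU hKc
  obtain ⟨A, M, hA, hcK⟩ := hcb _ hKU hKc
  set M' : ℝ := max M 0 with hM'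
  set Nm : ℝ := ∑ σ, N σ with hNm
  set Nm' : ℝ := ∑ σ, N' σ with hNm'
  have hNm0 : 0 ≤ Nm := Finset.sum_nonneg fun σ _ => hN σ
  have hNm'0 : 0 ≤ Nm' := Finset.sum_nonneg fun σ _ => hN' σ
  have hNle : ∀ σ, N σ ≤ Nm := fun σ => Finset.single_le_sum (f := N) (fun τ _ => hN τ) (Finset.mem_univ σ)
  have hN'le : ∀ σ, N' σ ≤ Nm' := fun σ => Finset.single_le_sum (f := N') (fun τ _ => hN' τ) (Finset.mem_univ σ)
  have hBK : Metric.ball s₀ (r / 2) ⊆ Metric.closedBall s₀ (r / 2) := Metric.ball_subset_closedBall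
  -- holomorphy on the open ball by the M-test
  suffices hD : DifferentiableOn ℂ (fun s : ℂ => ∑' i, c i s * ∏ σ, F i σ s) (Metric.ball s₀ (r / 2)) from
    (hD.differentiableAt (Metric.isOpen_ball.mem_nhds (Metric.mem_ball_self hr2))).differentiableWithinAt
  refine differentiableOn_tsum_of_summable_norm
    (u := fun i => A * (∏ σ, 2 * C σ) * ∏ σ, (w i σ *
      (1 + ((h i σ 0 0).re + (h i σ 1 1).re)) ^ (M' + Nm) * (1 + ((h i σ 0 0).re * (h i σ 1 1).re - normSq (h i σ 0 1)) ^ (-Nm'))))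
    ((hsum (M' + Nm) Nm' (add_nonneg (le_max_right _ _) hNm0) hNm'0).mul_left (A * ∏ σ, 2 * C σ)) (fun i => ?_) Metric.isOpen_ball (fun i s hs => ?_)
  · -- each term is holomorphic on the ball
    exact ((hc i).mono (hBK.trans hKU)).mul (DifferentiableOn.fun_finsetProd fun σ _ => (hF i σ).mono (hBK.trans hKU))
  · -- the M-test bound
    have h1 := hcK i s (hBK hs)
    have htr0 : ∀ σ, 0 < (h i σ 0 0).re + (h i σ 1 1).re := fun σ => trace_re_pos_of_posDef (hh i σ)
    have htr : ∀ σ, 0 < 1 + ((h i σ 0 0).re + (h i σ 1 1).re) := fun σ => by linarith [htr0 σ]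
    have hdet : ∀ σ, 0 < (h i σ 0 0).re * (h i σ 1 1).re - normSq (h i σ 0 1) := fun σ => by
      have hcσ := (posDef_hermTwo_iff ((h i σ 0 0).re, h i σ 0 1, (h i σ 1 1).re)).mp
        (by rw [hermTwo_eq_of_isHermitian (hh i σ).1]; exact hh i σ)
      simp only at hcσ
      linarith [hcσ.2]
    -- per place: `‖F_{iσ}(s)‖ ≤ C_σ w_{iσ} (1 + tr_σ)^{Nm} · 2 (1 + det_σ^{−Nm′})`
    have h2 : ∀ σ, ‖F i σ s‖ ≤ C σ * w i σ * (1 + ((h i σ 0 0).re + (h i σ 1 1).re)) ^ Nm *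
        (2 * (1 + ((h i σ 0 0).re * (h i σ 1 1).re - normSq (h i σ 0 1)) ^ (-Nm'))) := by
      intro σ
      refine (hB σ i s (hBK hs)).trans ?_
      have e1 : (1 + ((h i σ 0 0).re + (h i σ 1 1).re)) ^ N σ ≤ (1 + ((h i σ 0 0).re + (h i σ 1 1).re)) ^ Nm :=
        Real.rpow_le_rpow_of_exponent_le (by linarith [htr0 σ]) (hNle σ)
      have e2 : 1 + ((h i σ 0 0).re * (h i σ 1 1).re - normSq (h i σ 0 1)) ^ (-N' σ) ≤
          2 * (1 + ((h i σ 0 0).re * (h i σ 1 1).re - normSq (h i σ 0 1)) ^ (-Nm')) :=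
        one_add_rpow_neg_le_two_mul (hdet σ) (hN' σ) (hN'le σ)
      have hCe : 0 ≤ C σ * w i σ := mul_nonneg (hC σ) (hw i σ)
      exact mul_le_mul (mul_le_mul_of_nonneg_left e1 hCe) e2 (by linarith [Real.rpow_nonneg (hdet σ).le (-N' σ)])
        (mul_nonneg hCe (Real.rpow_nonneg (htr σ).le _))
    have h1' : ‖c i s‖ ≤ A * ∏ σ, (1 + ((h i σ 0 0).re + (h i σ 1 1).re)) ^ M' := by
      refine h1.trans (mul_le_mul_of_nonneg_left ?_ hA)
      exact Finset.prod_le_prod (fun σ _ => Real.rpow_nonneg (htr σ).le _) fun σ _ =>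
        Real.rpow_le_rpow_of_exponent_le (by linarith [htr0 σ]) (le_max_left _ _)
    rw [norm_mul, norm_prod]
    have hP0 : 0 ≤ ∏ σ, ‖F i σ s‖ := Finset.prod_nonneg fun σ _ => norm_nonneg _
    calc ‖c i s‖ * ∏ σ, ‖F i σ s‖
        ≤ (A * ∏ σ, (1 + ((h i σ 0 0).re + (h i σ 1 1).re)) ^ M') *
            ∏ σ, (C σ * w i σ * (1 + ((h i σ 0 0).re + (h i σ 1 1).re)) ^ Nm *
              (2 * (1 + ((h i σ 0 0).re * (h i σ 1 1).re - normSq (h i σ 0 1)) ^ (-Nm')))) :=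
          mul_le_mul h1' (Finset.prod_le_prod (fun σ _ => norm_nonneg _) fun σ _ => h2 σ) hP0
            (mul_nonneg hA (Finset.prod_nonneg fun σ _ => Real.rpow_nonneg (htr σ).le _))
      _ = A * (∏ σ, 2 * C σ) * ∏ σ, (w i σ *
            (1 + ((h i σ 0 0).re + (h i σ 1 1).re)) ^ (M' + Nm) * (1 + ((h i σ 0 0).re * (h i σ 1 1).re - normSq (h i σ 0 1)) ^ (-Nm'))) := by
          rw [mul_assoc A, mul_assoc A, ← Finset.prod_mul_distrib, ← Finset.prod_mul_distrib]
          congr 1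
          refine Finset.prod_congr rfl fun σ _ => ?_
          rw [Real.rpow_add (htr σ)]
          ring

/-! ## §2 The instance `F_{iσ}(s) = (d∕dt)^{n_σ} ξ(g₀σ + tΞ_σ, h_{iσ}; α₀σ + us, β₀σ + vs)|_{t=0}` -/

/-- **HOLOMORPHY OF THE LATTICE SERIES OF `t`-DERIVATIVES OF `Ξ` IN THE `g`-SLOT** (the general-`K_∞`-type face of Φ6b-5): for
`g₀σ = hermTwo (d σ) > 0`, directions `Ξ_σ`, orders `n_σ`, positive definite lattice points `h_{iσ}`, `U` open with `0 < re(β₀σ + vs)` on `U`,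
coefficients of polynomial growth and the lattice summability with weights `exp(−π re tr(h_{iσ} g₀σ))` (★ (H2) at `g = g₀∕2`),
`s ↦ Σ'_i c i s · ∏_σ (d∕dt)^{n_σ} xiShift (g₀σ + tΞ_σ) (h i σ) (α₀σ + us) (β₀σ + vs)|_{t=0}` is holomorphic on `U`. -/
theorem differentiableOn_tsum_prod_iteratedDeriv_xiShift {ι S : Type*} [Fintype S] (d : S → ℝ × ℂ × ℝ)
    (hd : ∀ σ, 0 < (d σ).1 ∧ normSq (d σ).2.1 < (d σ).1 * (d σ).2.2) (Ξ : S → Matrix (Fin 2) (Fin 2) ℂ) (n : S → ℕ)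
    (h : ι → S → Matrix (Fin 2) (Fin 2) ℂ) (hh : ∀ i σ, (h i σ).PosDef) (α₀ β₀ : S → ℂ) (u v : ℂ) {U : Set ℂ} (hU : IsOpen U)
    (hU0 : ∀ s ∈ U, ∀ σ, 0 < (β₀ σ + v * s).re) (c : ι → ℂ → ℂ) (hc : ∀ i, DifferentiableOn ℂ (c i) U)
    (hcb : ∀ K ⊆ U, IsCompact K → ∃ A M : ℝ, 0 ≤ A ∧ ∀ i, ∀ s ∈ K, ‖c i s‖ ≤ A * ∏ σ, (1 + ((h i σ 0 0).re + (h i σ 1 1).re)) ^ M)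
    (hsum : ∀ N N' : ℝ, 0 ≤ N → 0 ≤ N' → Summable fun i => ∏ σ, (Real.exp (-(Real.pi * ((h i σ * hermTwo (d σ)).trace).re)) *
      (1 + ((h i σ 0 0).re + (h i σ 1 1).re)) ^ N * (1 + ((h i σ 0 0).re * (h i σ 1 1).re - normSq (h i σ 0 1)) ^ (-N')))) :
    DifferentiableOn ℂ (fun s : ℂ => ∑' i, c i s *
      ∏ σ, iteratedDeriv (n σ) (fun t : ℂ => xiShift (hermTwo (d σ) + t • Ξ σ) (h i σ) (α₀ σ + u * s) (β₀ σ + v * s)) 0) U := by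
  -- the domination certificate and the `t`-holomorphy on the disc, place by place (★ (7b))
  choose r K hr hK hcert hdiffT using fun σ => exists_differentiableOn_xiShift_param (hd σ) (Ξ σ)
  refine differentiableOn_tsum_prod_of_bounds h hh (fun i σ => Real.exp (-(Real.pi * ((h i σ * hermTwo (d σ)).trace).re)))
    (fun i σ => (Real.exp_pos _).le) _ hU (fun i σ => ?_) (fun K' hK'U hK'c σ => ?_) c hc hcb hsum
  · -- holomorphy in `s` of the `t`-derivative (★ (7d))
    exact differentiableOn_iteratedDeriv_xiShift_param (hd σ) (Ξ σ) (hr σ) (fun t ht c' hc' => ((hcert σ) t ht c' hc').1) (hdiffT σ)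
      (hh i σ) (α₀ σ) (β₀ σ) u v hU (fun s hs => hU0 s hs σ) (n σ)
  · -- the three-factor bound of the `t`-derivative (★ (7c)): growth on the disc + Cauchy at `ρ = r∕2`
    have hKα : IsCompact ((fun s : ℂ => α₀ σ + u * s) '' K') := hK'c.image (by fun_prop)
    have hLβ : IsCompact ((fun s : ℂ => β₀ σ + v * s) '' K') := hK'c.image (by fun_prop)
    have hL0 : ∀ β ∈ (fun s : ℂ => β₀ σ + v * s) '' K', 0 < β.re := by
      rintro β ⟨s, hs, rfl⟩
      exact hU0 s (hK'U hs) σ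
    obtain ⟨C, N, N', hC, hN, hN', hB⟩ :=
      norm_xiShift_param_le₂ (hd σ) (Ξ σ) (hr σ).le (fun t ht c' hc' => ((hcert σ) t ht c' hc').1) hKα hLβ hL0
    have hρ : 0 < r σ / 2 := by linarith [hr σ]
    have hρr : r σ / 2 < r σ := by linarith [hr σ]
    refine ⟨(n σ).factorial * C / (r σ / 2) ^ (n σ), N, N', by positivity, hN, hN', fun i s hs => ?_⟩
    have hB' : ∀ t : ℂ, ‖t‖ ≤ r σ → ‖xiShift (hermTwo (d σ) + t • Ξ σ) (h i σ) (α₀ σ + u * s) (β₀ σ + v * s)‖ ≤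
        C * Real.exp (-(Real.pi * ((h i σ * hermTwo (d σ)).trace).re)) * (1 + ((h i σ 0 0).re + (h i σ 1 1).re)) ^ N *
          (1 + ((h i σ 0 0).re * (h i σ 1 1).re - normSq (h i σ 0 1)) ^ (-N')) := fun t ht =>
      hB t ht (h i σ) (hh i σ) _ ⟨s, hs, rfl⟩ _ ⟨s, hs, rfl⟩
    have hmain := norm_iteratedDeriv_xiShift_param_le hρ hρr ((hdiffT σ) (hh i σ) (α₀ σ + u * s) (hU0 s (hK'U hs) σ)) hB' (n σ)
    refine hmain.trans (le_of_eq ?_)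
    field_simp

end Summit.HodgeConjecture.HodgeConjecture.Cruxes.HLiu418.K2LiuHolomorphicLatticeSeriesOfBounds

end
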